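import Summits.AtomisticToContinuum.BoseEinsteinCondensation.Theorems.BECHardSphereReductionHardSphereBECMesoscopicWindow
import Summits.AtomisticToContinuum.BoseEinsteinCondensation.Theorems.BECHardSphereReductionHardSphereBECPositivityTransferHS

/-!
# Crux `HardSphereBEC` (stmt-11885), line `registered`, skeleton v4 — the physics kernel
# `stub_windowBoundNonneg` (S1w) is implied by the summit's `PositiveZeroMode` at `v := HS₁`

Route `BECHardSphereReduction`, lead c7 (2026-08-17).  `HS₁ = ⊤·1_{[0,1]}`, `L = L_N(η)`,
`φ₀ = L^{-3/2}·1_{Λ_L}`, Neumann index cut-offs `K` (`n₊ᴸ(K) = NeumannBox.nPlusLow K L N`).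

Skeleton v4 of `Cruxes/HardSphereBEC/Lines/birth.lean` isolates the physics kernel of the crux as the
registered stub `stub_windowBoundNonneg` (S1w): a sparse-in-density occupation bound for the mesoscopic
window `K₀ < π|k| ≤ √(32πη/c)·L` of the NONNEGATIVE near-minimisers of the unit-hard-sphere Dirichlet
energy.  Conversely to `ZeroModeDominance.sparsePositiveZeroMode_of_windowBound` (p160057: S1w ⟹ sparse
positive zero-mode condensation), this file records that S1w FOLLOWS from positive zero-mode
condensation — in particular from the crux `PositiveZeroMode` of route `BECRieszReverseHolder`
(the TARGET item stmt-AtomisticToContinuum-12839 of that route, decl of `Theses/BECRieszReverseHolder.lean`: for every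
admissible `v`, on an initial interval of densities, the nonnegative near-minimisers have
`⟨φ₀,γ_Ψφ₀⟩ ≥ cN`) evaluated at `v := HS₁`:

* `windowBoundNonneg_of_sparsePositiveZeroMode` — sparse positive zero mode (constant `c`) ⟹ S1w with
  constant `c/2` and `K₀ := 0` (`n₊ᴸ(K) + cN ≤ N ≤ n₊ᴸ(0) + N` by `nPlusLow_add_le_of_zeroMode`, p147997);
* `windowBoundNonneg_of_positiveZeroMode` — **`PositiveZeroMode` ⟹ S1w** (interval ⟹ sparse).

So S1w is, up to constants, EQUIVALENT to sparse positive zero-mode condensation of unit hard spheres,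
and every positivity route of the summit proving `PositiveZeroMode` (or its hard-sphere instance) closes
S1w; with S1r (⟸ 9072) and S2' (⟸ 11884 | 11886) it closes the crux (`HardSphereBEC_of` of the skeleton).
-/

noncomputable section

namespace Summit.AtomisticToContinuum.BoseEinsteinCondensation.Cruxes.HardSphereBEC

open MeasureTheory ENNReal Filter Topology Literature.MathematicalPhysics.QuantumManyBody.BoseGas
open Literature.MathematicalPhysics.QuantumManyBody.NeumannBox
open Summit.AtomisticToContinuum.BoseEinsteinCondensation.Theorems

/-- **Sparse positive zero-mode condensation gives the sparse window bound S1w** (constant `c/2`,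
far-infrared cut-off `K₀ := 0`): a zero-mode bound `cN` leaves at most `N - cN` for ALL non-constant
modes (`nPlusLow_add_le_of_zeroMode`), a fortiori for the window. [folklore] -/
theorem windowBoundNonneg_of_sparsePositiveZeroMode
    (h : ∀ η₀ : ℝ, 0 < η₀ → ∃ η : ℝ, 0 < η ∧ η ≤ η₀ ∧ ∃ c : ℝ, 0 < c ∧ ∀ᶠ N : ℕ in Filter.atTop,
      ∃ δ : ENNReal, 0 < δ ∧ ∀ Ψ : TrialState N (sideLength η N),
        energy (Set.indicator (Set.Iic 1) (fun _ : ℝ => (⊤ : ENNReal))) Ψ ≤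
          groundStateEnergy (Set.indicator (Set.Iic 1) (fun _ : ℝ => (⊤ : ENNReal))) N
            (sideLength η N) + δ →
        (∀ X, Ψ.ψ X = (‖Ψ.ψ X‖ : ℂ)) →
        ENNReal.ofReal (c * N) ≤ occupation N ((box (sideLength η N)).indicator
          fun _ => ((Real.sqrt (sideLength η N ^ 3))⁻¹ : ℂ)) Ψ.ψ) :
    ∀ η₀ : ℝ, 0 < η₀ → ∃ η : ℝ, 0 < η ∧ η ≤ η₀ ∧ ∃ c : ℝ, 0 < c ∧ ∃ K₀ : ℝ, ∀ᶠ N : ℕ in Filter.atTop, ∃ δ : ENNReal, 0 < δ ∧ ∀ Ψ : Literature.MathematicalPhysics.QuantumManyBody.BoseGas.TrialState N (Literature.MathematicalPhysics.QuantumManyBody.BoseGas.sideLength η N), Literature.MathematicalPhysics.QuantumManyBody.BoseGas.energy (Set.indicator (Set.Iic 1) (fun _ : ℝ => (⊤ : ENNReal))) Ψ ≤ Literature.MathematicalPhysics.QuantumManyBody.BoseGas.groundStateEnergy (Set.indicator (Set.Iic 1) (fun _ : ℝ => (⊤ : ENNReal))) N (Literature.MathematicalPhysics.QuantumManyBody.BoseGas.sideLength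 η N) + δ → (∀ X, Ψ.ψ X = (‖Ψ.ψ X‖ : ℂ)) → Literature.MathematicalPhysics.QuantumManyBody.NeumannBox.nPlusLow (Real.sqrt (32 * Real.pi * η / c) * Literature.MathematicalPhysics.QuantumManyBody.BoseGas.sideLength η N) (Literature.MathematicalPhysics.QuantumManyBody.BoseGas.sideLength η N) N Ψ.ψ + ENNReal.ofReal (2 * c * N) ≤ Literature.MathematicalPhysics.QuantumManyBody.NeumannBox.nPlusLow K₀ (Literature.MathematicalPhysics.QuantumManyBody.BoseGas.sideLength η N) N Ψ.ψ + (N : ENNReal) := by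
  intro η₀ hη₀
  obtain ⟨η, hη, hηle, c, hc, hev⟩ := h η₀ hη₀
  refine ⟨η, hη, hηle, c / 2, half_pos hc, 0, ?_⟩
  filter_upwards [hev, eventually_gt_atTop 0] with N hN hN0
  obtain ⟨δ, hδ, hΨ⟩ := hN
  cases N with
  | zero => exact absurd hN0 (lt_irrefl 0)
  | succ n =>
    refine ⟨δ, hδ, fun Ψ hΨE hpos => ?_⟩
    have hL : 0 < sideLength η (n + 1) :=
      Real.rpow_pos_of_pos (div_pos (by exact_mod_cast Nat.succ_pos n) hη) _
    have h2 : 2 * (c / 2) * ((n + 1 : ℕ) : ℝ) = c * ((n + 1 : ℕ) : ℝ) := by ring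
    rw [h2]
    exact (nPlusLow_add_le_of_zeroMode (by positivity) hL Ψ (hΨ Ψ hΨE hpos)).trans le_add_self

/-- **`PositiveZeroMode` (route `BECRieszReverseHolder`) at `v := HS₁` gives the sparse window bound
S1w**: an interval of good densities is in particular a sparse set of them (`η := min η₀ (ρ₀/2)`).
[folklore] -/
theorem windowBoundNonneg_of_positiveZeroMode
    (h : Summit.AtomisticToContinuum.BoseEinsteinCondensation.Theses.BECRieszReverseHolder.PositiveZeroMode) :
    ∀ η₀ : ℝ, 0 < η₀ → ∃ η : ℝ, 0 < η ∧ η ≤ η₀ ∧ ∃ c : ℝ, 0 < c ∧ ∃ K₀ : ℝ, ∀ᶠ N : ℕ in Filter.atTop, ∃ δ : ENNReal, 0 < δ ∧ ∀ Ψ : Literature.MathematicalPhysics.QuantumManyBody.BoseGas.TrialState N (Literature.MathematicalPhysics.QuantumManyBody.BoseGas.sideLength η N), Literature.MathematicalPhysics.QuantumManyBody.BoseGas.energy (Set.indicator (Set.Iic 1) (fun _ : ℝ => (⊤ : ENNReal))) Ψ ≤ Literature.MathematicalPhysics.QuantumManyBody.BoseGas.groundStateEnergy (Set.indicator (Set.Iic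 1) (fun _ : ℝ => (⊤ : ENNReal))) N (Literature.MathematicalPhysics.QuantumManyBody.BoseGas.sideLength η N) + δ → (∀ X, Ψ.ψ X = (‖Ψ.ψ X‖ : ℂ)) → Literature.MathematicalPhysics.QuantumManyBody.NeumannBox.nPlusLow (Real.sqrt (32 * Real.pi * η / c) * Literature.MathematicalPhysics.QuantumManyBody.BoseGas.sideLength η N) (Literature.MathematicalPhysics.QuantumManyBody.BoseGas.sideLength η N) N Ψ.ψ + ENNReal.ofReal (2 * c * N) ≤ Literature.MathematicalPhysics.QuantumManyBody.NeumannBox.nPlusLow K₀ (Literature.MathematicalPhysics.QuantumManyBody.BoseGas.sideLength η N) N Ψ.ψ + (N : ENNReal) := by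
  obtain ⟨ρ₀, hρ₀, H⟩ := h _ isRepulsiveFiniteRange_unitHardSphere
  refine windowBoundNonneg_of_sparsePositiveZeroMode fun η₀ hη₀ => ?_
  refine ⟨min η₀ (ρ₀ / 2), lt_min hη₀ (half_pos hρ₀), min_le_left _ _, ?_⟩
  exact H _ (lt_min hη₀ (half_pos hρ₀)) ((min_le_right _ _).trans_lt (half_lt_self hρ₀))

end Summit.AtomisticToContinuum.BoseEinsteinCondensation.Cruxes.HardSphereBEC

end
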